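import Literature.RepresentationTheory.FiniteGroups.StableLatticeReductionFiniteTorsion
import HarnessLib

/-!
# `ψ(X/pX) = ψ(X[p])` for finite `X` — instance-polymorphic, presentation-agnostic form

Topic `RepresentationTheory/FiniteGroups`; namespace
`Literature.RepresentationTheory.FiniteGroups.StableLatticeReduction.Int`.  THEOREMS ONLY (no
definition, no named fact, no `sorry`, no instance).

`StableLatticeReductionFiniteTorsion.additive_reduction_eq_torsionBy_of_finite` proves, for an
additive invariant `ψ` of `ℤ[G]`-modules (hypothesis `hψ`: additivity on short exact sequences of
finite modules killed by a prime `p`) and a finite `ℤ[G]`-module `X`, that `ψ(X/pX) = ψ(X[p])` — with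
`X/pX` presented as the quotient by `(p : ℤ) • ⊤` and `X[p]` as `Submodule.torsionBy ℤ X p`, and with
the `ℤ`-module structure `AddCommGroup.toIntModule X`.  Consumers whose carriers come with their own
(propositionally but not definitionally equal) `Module ℤ X` — e.g. `ModuleCat` carriers of cohomology
groups — and who present `pX`, `X[p]` as kernels / images cannot instantiate that statement
directly.  **`additive_quotient_eq_subrepresentation_of_finite`** is the same fact for an ARBITRARY
`[Module ℤ X]` and for ANY `G`-stable submodules `N`, `N'` characterised only by membership
(`x ∈ N ↔ ∃ y, p • y = x`, `x ∈ N' ↔ p • x = 0`, integer scalar multiplication); it is derived from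
the normalised statement by `Subsingleton (Module ℤ X)` and `Submodule.ext`.  Lane «TATE-EPC-TC» of
cell `bsd-eis`, brick B8-γ (agnostic form, asked by -w4 g17 for the Kummer pieces of `𝓗ⁿ(E_S)`).

## References
* [SerreLinearRepresentations1977] J.-P. Serre, *Linear Representations of Finite Groups*,
  §§14.1, 15.2, 16.1 (Thm. 32: reduction of stable lattices; Brauer characters mod `p`).
* [MilneADT2006] J. S. Milne, *Arithmetic Duality Theorems*, I §5 (proof of Thm. 5.1, the additive
  Euler-characteristic `φ` on finite modules killed by `p`).
-/

universe u

namespace Literature.RepresentationTheory.FiniteGroups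

namespace StableLatticeReduction.Int

open Function LinearMap Submodule StableLatticeReduction
open scoped Pointwise

variable {G : Type*} [Monoid G] {A : Type*} [AddCommGroup A] {p : ℕ}

/- `ψ` takes its instance arguments as STRICT-IMPLICIT binders: the same Π-type as the usual
`∀ ⦃X⦄ [AddCommGroup X] [Module ℤ X], …` (binder annotations are irrelevant to definitional equality,
so a consumer's `ψ`/`hψ` with instance binders is accepted verbatim), but applications `ψ ρ` then take
the `Module ℤ` structure from the type of `ρ` by unification instead of re-synthesising it. -/
variable (ψ : ∀ ⦃X : Type u⦄ ⦃_ : AddCommGroup X⦄ ⦃_ : Module ℤ X⦄, Representation ℤ G X → A)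
  (hψ : ∀ ⦃X Y Z : Type u⦄ [AddCommGroup X] [Module ℤ X] [AddCommGroup Y] [Module ℤ Y]
    [AddCommGroup Z] [Module ℤ Z] (ρX : Representation ℤ G X) (ρY : Representation ℤ G Y)
    (ρZ : Representation ℤ G Z) (f : X →ₗ[ℤ] Y) (g : Y →ₗ[ℤ] Z),
    (∀ s x, f (ρX s x) = ρY s (f x)) → (∀ s y, g (ρY s y) = ρZ s (g y)) →
    Injective f → Surjective g → LinearMap.range f = LinearMap.ker g → Finite Y →
    (∀ y : Y, (p : ℤ) • y = 0) → ψ ρY = ψ ρX + ψ ρZ)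
include hψ

/-- **`ψ(X/pX) = ψ(X[p])` for a finite `ℤ[G]`-module `X`, instance-polymorphic and
presentation-agnostic**: for ANY `ℤ`-module structure on the abelian group `X` and any `G`-stable
submodules `N = pX` and `N' = X[p]` given only through their membership characterisations (integer
scalar multiplication), `ψ (X/N) = ψ (N')`.  Derived from
`additive_reduction_eq_torsionBy_of_finite` (the case `Module ℤ X := AddCommGroup.toIntModule X`,
`N := (p : ℤ) • ⊤`, `N' := torsionBy ℤ X p`) by uniqueness of `ℤ`-module structures.
[cite: SerreLinearRepresentations1977, §15.2 and §16.1 Thm. 32]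
[cite: MilneADT2006, I §5 (proof of Thm. 5.1)] -/
theorem additive_quotient_eq_subrepresentation_of_finite [Fact p.Prime] {X : Type u}
    [AddCommGroup X] [instM : Module ℤ X] [Finite X] (ρX : Representation ℤ G X)
    (N N' : Submodule ℤ X) (hN : ∀ x, x ∈ N ↔ ∃ y : X, (p : ℤ) • y = x)
    (hN' : ∀ x, x ∈ N' ↔ (p : ℤ) • x = 0) (hNρ : ∀ g, N ≤ N.comap (ρX g))
    (hN'ρ : ∀ g, N' ≤ N'.comap (ρX g)) :
    ψ (ρX.quotient N hNρ) = ψ (ρX.subrepresentation N' hN'ρ) := by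
  -- normalise the `ℤ`-module structure
  have hinst : instM = AddCommGroup.toIntModule X := Subsingleton.elim _ _
  subst hinst
  -- identify the two submodules
  have hNeq : N = (p : ℤ) • (⊤ : Submodule ℤ X) := by
    ext x
    rw [hN, Int.mem_smul_top_iff]
  have hN'eq : N' = torsionBy ℤ X (p : ℤ) := by
    ext x
    rw [hN', mem_torsionBy_iff]
  subst hNeq
  subst hN'eq
  exact additive_reduction_eq_torsionBy_of_finite ψ hψ ρX

/-- The same with the roles of hypothesis and conclusion spelled through linear maps: if
`π : X →ₗ[ℤ] X` is multiplication by `p` (`π x = p • x`), then for the `G`-stable submodules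
`N = range π` and `N' = ker π` one has `ψ (X/N) = ψ (N')`.
[cite: SerreLinearRepresentations1977, §15.2 and §16.1 Thm. 32]
[cite: MilneADT2006, I §5 (proof of Thm. 5.1)] -/
theorem additive_quotient_range_eq_subrepresentation_ker_of_finite [Fact p.Prime] {X : Type u}
    [AddCommGroup X] [Module ℤ X] [Finite X] (ρX : Representation ℤ G X) (π : X →ₗ[ℤ] X)
    (hπ : ∀ x, π x = (p : ℤ) • x) (hNρ : ∀ g, LinearMap.range π ≤ (LinearMap.range π).comap (ρX g))
    (hN'ρ : ∀ g, LinearMap.ker π ≤ (LinearMap.ker π).comap (ρX g)) :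
    ψ (ρX.quotient (LinearMap.range π) hNρ) =
      ψ (ρX.subrepresentation (LinearMap.ker π) hN'ρ) :=
  additive_quotient_eq_subrepresentation_of_finite ψ hψ ρX _ _
    (fun x => by simp only [LinearMap.mem_range, hπ])
    (fun x => by rw [LinearMap.mem_ker, hπ]) hNρ hN'ρ

/-- The same with the membership characterisations in natural-number scalar multiplication
(`x ∈ N ↔ ∃ y, p • y = x`, `x ∈ N' ↔ p • x = 0`, `p • ·` the canonical `ℕ`-action).
[cite: SerreLinearRepresentations1977, §15.2 and §16.1 Thm. 32]
[cite: MilneADT2006, I §5 (proof of Thm. 5.1)] -/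
theorem additive_quotient_eq_subrepresentation_of_finite_nsmul [Fact p.Prime] {X : Type u}
    [AddCommGroup X] [Module ℤ X] [Finite X] (ρX : Representation ℤ G X)
    (N N' : Submodule ℤ X) (hN : ∀ x, x ∈ N ↔ ∃ y : X, p • y = x)
    (hN' : ∀ x, x ∈ N' ↔ p • x = 0) (hNρ : ∀ g, N ≤ N.comap (ρX g))
    (hN'ρ : ∀ g, N' ≤ N'.comap (ρX g)) :
    ψ (ρX.quotient N hNρ) = ψ (ρX.subrepresentation N' hN'ρ) :=
  additive_quotient_eq_subrepresentation_of_finite ψ hψ ρX N N'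
    (fun x => by simp only [hN, natCast_zsmul]) (fun x => by rw [hN', natCast_zsmul]) hNρ hN'ρ

end StableLatticeReduction.Int

end Literature.RepresentationTheory.FiniteGroups
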